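import Summits.Ventures.PercRepro.SevenThreeStarTable

/-!
# PercRepro — the `(7,3)` cell: reading the star table at a datum (p3, gen 16)

The star table (`SevenThreeStarTable.lean`) is a `decide`d statement over sorted `n`-vectors of length `9`. This file
reads it at a datum: `allSortedSum_spec` unpacks the enumeration (every descending list of length `d` with entries
`≤ mx` and sum `≤ rem` passes the test), `cellOK_spec` unpacks a cell (a realisable datum has exact divisions `divOK`
and `starBound ℓ₀ ≤ deltaStarN`), and the zero-padding lemmas (`DstarN_append_zeros`, `deltaStarN_append_zeros`,
`divOK_append_zeros`) show that the class vector of a cyclic part may be padded with zeros to length `9`.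
`starTable_at`: for `t_P ≤ 1`, `ℓ₀ ≤ 3`, `c_P ≤ 5` and a descending vector `cs` of length `9` with entries `≤ 9`
and sum `≤ 10 − t_P − c_P − ℓ₀`, `cellOK t_P c_P ℓ₀ cs = true`. Mathlib + the table only.
-/

namespace PercRepro

namespace SevenThree

namespace StarApply

open StarTable

/-- A descending list with head `≤ mx`. -/
def Desc : ℕ → List ℕ → Prop
  | _, [] => True
  | mx, n :: l => n ≤ mx ∧ Desc n l

/-- `Desc` for a list whose entries are all `≤ mx` and which is pairwise non-increasing. -/
theorem desc_of_pairwise {mx : ℕ} {l : List ℕ} (hle : ∀ x ∈ l, x ≤ mx) (hp : l.Pairwise (fun a b => b ≤ a)) :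
    Desc mx l := by
  induction l generalizing mx with
  | nil => trivial
  | cons n l ih =>
    rw [List.pairwise_cons] at hp
    exact ⟨hle n (List.mem_cons_self ..), ih (fun x hx => hp.1 x hx) hp.2⟩

/-- **The enumeration unpacked**: every descending list of length `d` with head `≤ mx` and sum `≤ rem` passes. -/
theorem allSortedSum_spec (p : List ℕ → Bool) (d : ℕ) :
    ∀ (mx rem : ℕ) (acc : List ℕ), allSortedSum p d mx rem acc = true →
      ∀ l : List ℕ, l.length = d → Desc mx l → l.sum ≤ rem → p (acc.reverse ++ l) = true := by
  induction d with
  | zero =>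
    intro mx rem acc h l hl _ _
    rw [List.length_eq_zero_iff] at hl
    subst hl
    rw [List.append_nil]
    exact h
  | succ d ih =>
    intro mx rem acc h l hl hd hs
    cases l with
    | nil => simp at hl
    | cons n l' =>
      rw [List.length_cons] at hl
      obtain ⟨hn, hd'⟩ := hd
      rw [List.sum_cons] at hs
      unfold allSortedSum at h
      rw [List.all_eq_true] at h
      have h1 := h n (List.mem_range.2 (by omega))
      have := ih n (rem - n) (n :: acc) h1 l' (by omega) hd' (by omega)
      rw [List.reverse_cons, List.append_assoc, List.singleton_append] at this
      exact this

/-- A cell unpacked: a realisable datum has exact divisions and `starBound ℓ₀ ≤ deltaStarN`. -/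
theorem cellOK_spec {tP cP l0 : ℕ} {cs : List ℕ} (h : cellOK tP cP l0 cs = true) (hre : realisable tP cP l0 cs = true) :
    divOK tP cP l0 cs = true ∧ starBound l0 ≤ deltaStarN tP cP l0 cs := by
  unfold cellOK at h
  rw [Bool.or_eq_true, Bool.not_eq_true', Bool.and_eq_true, decide_eq_true_iff] at h
  rcases h with h | h
  · rw [hre] at h
    exact absurd h (by decide)
  · exact h

/-- **The star table at a datum**: `t_P ≤ 1`, `ℓ₀ ≤ 3`, `c_P ≤ 5`, `cs` descending of length `9` with head `≤ 9` and
sum `≤ 10 − t_P − c_P − ℓ₀` give `cellOK t_P c_P ℓ₀ cs = true`. -/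
theorem starTable_at {tP cP l0 : ℕ} (htP : tP ≤ 1) (hl0 : l0 ≤ 3) (hcP : cP ≤ 5) {cs : List ℕ} (hlen : cs.length = 9)
    (hd : Desc 9 cs) (hs : cs.sum ≤ 10 - tP - cP - l0) : cellOK tP cP l0 cs = true := by
  have h := starTable tP (by omega) l0 (by omega)
  unfold starCheck at h
  rw [List.all_eq_true] at h
  have h1 := h cP (List.mem_range.2 (by omega))
  have := allSortedSum_spec (cellOK tP cP l0) 9 9 (10 - tP - cP - l0) [] h1 cs hlen hd hs
  rw [List.reverse_nil, List.nil_append] at this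
  exact this

/-- `cycRec` ignores a class of size `0`. -/
theorem cycRec_zero_cons (cs : List ℕ) (rem hits : ℕ) (min2 : Bool) (mult : ℕ) :
    cycRec (0 :: cs) rem hits min2 mult = cycRec cs rem hits min2 mult := by
  show sumToN (min 0 rem) (fun v => cycRec cs (rem - v) (hits + if v = 0 then 0 else 1)
    (min2 && (decide (v = 0) || decide (2 ≤ v))) (mult * Nat.choose 0 v)) = cycRec cs rem hits min2 mult
  simp [sumToN]

/-- `cycRec` on a list of zeros is `cycRec []`. -/
theorem cycRec_replicate_zero (k rem hits : ℕ) (min2 : Bool) (mult : ℕ) :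
    cycRec (List.replicate k 0) rem hits min2 mult = cycRec [] rem hits min2 mult := by
  induction k with
  | zero => rfl
  | succ k ih => rw [List.replicate_succ, cycRec_zero_cons, ih]

/-- `cycRec` ignores trailing zeros. -/
theorem cycRec_append_zeros (cs : List ℕ) (k : ℕ) :
    ∀ (rem hits : ℕ) (min2 : Bool) (mult : ℕ),
      cycRec (cs ++ List.replicate k 0) rem hits min2 mult = cycRec cs rem hits min2 mult := by
  induction cs with
  | nil =>
    intro rem hits min2 mult
    rw [List.nil_append, cycRec_replicate_zero]
  | cons c cs ih =>
    intro rem hits min2 mult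
    rw [List.cons_append]
    unfold cycRec
    congr 1
    funext v
    exact ih _ _ _ _

/-- `cyc` ignores trailing zeros. -/
theorem cyc_append_zeros (cs : List ℕ) (k j : ℕ) : cyc (cs ++ List.replicate k 0) j = cyc cs j := by
  unfold cyc
  exact cycRec_append_zeros cs k j 0 true 1

/-- `withinSum` ignores trailing zeros. -/
theorem withinSum_append_zeros (lp nu : ℕ) (cs : List ℕ) (k : ℕ) :
    withinSum lp nu (cs ++ List.replicate k 0) = withinSum lp nu cs := by
  induction cs with
  | nil =>
    rw [List.nil_append]
    induction k with
    | zero => rfl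
    | succ k ih =>
      rw [List.replicate_succ]
      show sumTo 0 (fun j => if 2 ≤ j then (Nat.choose 0 j : ℤ) * chooseSub lp (nu + 1) j else 0) +
        withinSum lp nu (List.replicate k 0) = withinSum lp nu []
      rw [ih]
      simp [sumTo, withinSum]
  | cons c cs ih =>
    rw [List.cons_append, withinSum, withinSum, ih]

/-- `DstarN` ignores trailing zeros of the class vector. -/
theorem DstarN_append_zeros (lp : ℕ) (cs : List ℕ) (k x : ℕ) :
    DstarN lp (cs ++ List.replicate k 0) x = DstarN lp cs x := by
  unfold DstarN
  rw [withinSum_append_zeros, List.sum_append, List.sum_replicate, smul_zero, add_zero]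
  congr 1
  congr 1
  funext j
  rw [cyc_append_zeros]

/-- `bracketN` ignores trailing zeros. -/
theorem bracketN_append_zeros (tP cP l0 : ℕ) (cs : List ℕ) (k zP zl : ℕ) :
    bracketN tP cP l0 (cs ++ List.replicate k 0) zP zl = bracketN tP cP l0 cs zP zl := by
  unfold bracketN
  rw [DstarN_append_zeros]

/-- `deltaStarN` ignores trailing zeros. -/
theorem deltaStarN_append_zeros (tP cP l0 : ℕ) (cs : List ℕ) (k : ℕ) :
    deltaStarN tP cP l0 (cs ++ List.replicate k 0) = deltaStarN tP cP l0 cs := by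
  unfold deltaStarN
  congr 1
  funext zP
  split_ifs
  · rfl
  · congr 1
    funext zl
    rw [bracketN_append_zeros]

/-- `divOK` ignores trailing zeros. -/
theorem divOK_append_zeros (tP cP l0 : ℕ) (cs : List ℕ) (k : ℕ) :
    divOK tP cP l0 (cs ++ List.replicate k 0) = divOK tP cP l0 cs := by
  unfold divOK
  simp only [DstarN_append_zeros]

end StarApply

end SevenThree

end PercRepro
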